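import Mathlib
import Literature.Analysis.FluidPDE.VectorCalculus
import Literature.Analysis.FluidPDE.VorticityCalculus
import HarnessLib

/-!
# Crux `PoloidalLiouville` (stmt-NavierStokesRegularity-1222, W1), crux idea «silent-shells» (ns-idea-15):
# structure of UNTHREADED fields — the easy half of «unthreaded ⟺ U = T·x + ∇φ» (E0 exploration)

The residual inviscid crux E0 `UnthreadedCompactonTrivial` of the silent-shells card concerns compactly supported steady
Euler flows UNTHREADED about a point (`⟪x, curl U x⟫ = 0`: vorticity tangent to every sphere about `0`).  The card
records the structure «unthreaded ⟺ `U = T·x + ∇φ` (toroidal potential `T`)».  This file proves the elementary half in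
the kernel, as information for the custodian and for any future E0 attack:

* `curl_smul_id` — `curl (T·x) = ∇T × x` (so radial-modulated position fields have sphere-tangent vorticity);
* `inner_curl_smul_id` — `⟪x, curl (T·x)(x)⟫ = 0`;
* `isUnthreadedAbout_zero_of_toroidalPotential` — `U = T·x + ∇φ` with `T ∈ C¹`, `φ ∈ C²` is unthreaded about `0`
  (`curl ∇φ = 0` is the tree's `curl_gradient_eq_zero_holds`).

The converse (every `C¹` unthreaded field is `T·x + ∇φ`: on each sphere the tangential part has zero circulation around
every loop, hence is a surface gradient; glue radially) is recorded on paper in the exploration note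
`HOME/ARM-B/jx-eng4g5/E0-EXPLORATION.md`, with the point-source virial identity and where Jiu–Xin's engine stops.

`--supports stmt-NavierStokesRegularity-1222 --as helper`; information-grade; W1 movement 0; E0 OPEN; NS regularity is NOT
proved by any of this.
-/

-- the summit and its single problem share the name (D-0017 nested layout)
set_option linter.dupNamespace false

noncomputable section

namespace Summit.NavierStokesRegularity.NavierStokesRegularity.Theorems.PoloidalLiouville.SilentShells

open scoped RealInnerProductSpace
open Literature.Analysis.FluidPDE

namespace E0

/-- The derivative of the radial-modulated position field `y ↦ T(y) y`. -/
theorem hasFDerivAt_smul_id {T : EuclideanSpace ℝ (Fin 3) → ℝ} {x : EuclideanSpace ℝ (Fin 3)}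
    (hT : DifferentiableAt ℝ T x) :
    HasFDerivAt (fun y => T y • y) (T x • ContinuousLinearMap.id ℝ _ + (fderiv ℝ T x).smulRight x) x :=
  hT.hasFDerivAt.smul (hasFDerivAt_id x)

/-- **`curl (T·x) = ∇T × x`**, in coordinates: the `i`-th component of `curl (y ↦ T y • y)` at `x`. -/
theorem curl_smul_id {T : EuclideanSpace ℝ (Fin 3) → ℝ} {x : EuclideanSpace ℝ (Fin 3)}
    (hT : DifferentiableAt ℝ T x) :
    curl (fun y => T y • y) x =
      WithLp.toLp 2 ![gradient T x 1 * x 2 - gradient T x 2 * x 1,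
        gradient T x 2 * x 0 - gradient T x 0 * x 2, gradient T x 0 * x 1 - gradient T x 1 * x 0] := by
  have hD := (hasFDerivAt_smul_id hT).fderiv
  have hg : ∀ j : Fin 3, fderiv ℝ T x (EuclideanSpace.single j 1) = gradient T x j := by
    intro j
    rw [show fderiv ℝ T x (EuclideanSpace.single j 1) = ⟪gradient T x, EuclideanSpace.single j 1⟫ by
      rw [gradient, InnerProductSpace.toDual_symm_apply], EuclideanSpace.inner_single_right]
    simp
  unfold curl
  simp only [hD]
  congr 1
  funext i
  fin_cases i <;> simp [hg]

/-- **Radial-modulated position fields are unthreaded about `0`**: `⟪x, curl (T·x)(x)⟫ = 0`. -/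
theorem inner_curl_smul_id {T : EuclideanSpace ℝ (Fin 3) → ℝ} {x : EuclideanSpace ℝ (Fin 3)}
    (hT : DifferentiableAt ℝ T x) : ⟪x, curl (fun y => T y • y) x⟫ = 0 := by
  rw [curl_smul_id hT]
  simp only [PiLp.inner_apply, Fin.sum_univ_three, RCLike.inner_apply, conj_trivial]
  simp
  ring

/-- **The easy half of «unthreaded ⟺ `U = T·x + ∇φ`»**: a field of the form `U = T·x + ∇φ` (`T ∈ C¹` toroidal
potential, `φ ∈ C²`) has vorticity tangent to every sphere about `0` — it is unthreaded about `0` in the sense of the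
silent-shells sketch (`IsUnthreadedAbout 0 U`, δ-unfolded: `∀ x, ⟪x − 0, curl U x⟫ = 0`). -/
theorem isUnthreadedAbout_zero_of_toroidalPotential {T φ : EuclideanSpace ℝ (Fin 3) → ℝ} (hT : ContDiff ℝ 1 T)
    (hφ : ContDiff ℝ 2 φ) : ∀ x : EuclideanSpace ℝ (Fin 3), ⟪x - 0, curl (fun y => T y • y + gradient φ y) x⟫ = 0 := by
  intro x
  have hTd : DifferentiableAt ℝ T x := hT.differentiable one_ne_zero x
  have h1 : DifferentiableAt ℝ (fun y => T y • y) x := (hasFDerivAt_smul_id hTd).differentiableAt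
  have h2 : DifferentiableAt ℝ (gradient φ) x := by
    have : ContDiff ℝ 1 (gradient φ) := by
      have h := hφ.fderiv_right (m := 1) le_rfl
      exact (InnerProductSpace.toDual ℝ (EuclideanSpace ℝ (Fin 3))).symm.contDiff.comp h
    exact this.differentiable one_ne_zero x
  rw [sub_zero, curl_add h1 h2, curl_gradient_eq_zero_holds φ hφ x, add_zero]
  exact inner_curl_smul_id hTd

end E0

end Summit.NavierStokesRegularity.NavierStokesRegularity.Theorems.PoloidalLiouville.SilentShells

end
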